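import Literature.RingTheory.HilbertSamuel.NormalConeFibreIdeal
import Literature.RingTheory.HilbertSamuel.NormalFlatnessHilbertFunction
import Literature.RingTheory.HilbertSamuel.TangentConeIdeal
import Literature.RingTheory.MvPolynomial.HilbertFunctionPolynomialExtensionAppend
import Literature.AlgebraicGeometry.Resolution.RegularLocalRingsProofs
import Mathlib.RingTheory.Localization.AtPrime.Basic
import HarnessLib

/-!
# The Hironaka–Grothendieck isomorphism along a regular normally flat centre — discharge of
# `HerrmannIkedaOrbanz1988_cor_21_11` (HIO 1988 Cor. (21.11) (1) ⇒ (2); CJS 2020 Thm. 3.2 (2) (i) ⇒ (iii);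
# Hironaka 1970 p. 170)

Topic: `Literature/RingTheory/HilbertSamuel`. `NormalConeFibreIdeal.lean` types the named fact: for a noetherian
local ring `(A, 𝔪, k)`, an ideal `I = (g_1, …, g_m)` with `A/I` regular of dimension `s`, `I` normally flat, and
`y_1, …, y_s` with `(g, y)` generating `𝔪`, the ideal of initial forms `J_z ⊆ k[Z_1, …, Z_{m+s}]` of `A` w.r.t.
`z = (g, y)` EQUALS the extension `J_D · k[Z]` of the ideal `J_D ⊆ k[X_1, …, X_m]` of the fibre of the normal cone
(«`G(𝔭, x) : (G(𝔭,R) ⊗ k)[T] → G(𝔪,R)` is an isomorphism»). This file PROVES it (`HerrmannIkedaOrbanz1988_cor_21_11_holds`).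

## Proof (by Hilbert functions; no graded rings)

`J_D · k[Z] ⊆ J_z` is the trivial half (`map_rename_normalConeIdeal_le_tangentConeIdeal`, typed file). Both ideals are
homogeneous, so equality follows from the degreewise dimension inequality `dim_k (k[Z]/J_D k[Z])_d ≤ dim_k (k[Z]/J_z)_d`,
which is the chain

  `H(k[Z]/J_D k[Z])(d) = Σ_{i ≤ d} H(k[X]/J_D)(i) · Φ^{(s)}(d−i)`   (`HilbertFunctionPolynomialExtensionAppend`:
      the Hilbert function of a polynomial extension in `s` variables, CJS Lemma 2.37 (1), and `sum_mul_iterPSum_Phi`)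
  `≤ Σ_{i ≤ d} μ(I^i) · Φ^{(s)}(d−i)`   (**`hilbertFunQuot_normalConeIdeal_le_spanFinrank`**, this file: `k[X]_i` is
      spanned modulo `(J_D)_i` by the reductions of `μ(I^i)` forms `W_j` of degree `i` with `{W_j(g)}` a minimal
      generating set of `I^i` — every monomial `X^α`, `|α| = i`, satisfies `g^α = Σ a_j W_j(g)`, so
      `X^α − Σ a_j W_j` reduces into `normalConeForms g i`)
  `≤ Σ_{i ≤ d} H^{(0)}[A_I](i) · Φ^{(s)}(d−i) = H^{(s)}[A_I](d) = H^{(0)}[A](d) = H(k[Z]/J_z)(d)`   (normal flatness: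
      `spanFinrank_pow_le_hilbertFun_of_free`, `hilbertFun_eq_hilbertSamuelFun_of_isNormallyFlat` — CJS Thm. 3.3 /
      HIO Cor. (21.12), tree file `NormalFlatnessHilbertFunction.lean` — and `hilbertFunQuot_tangentConeIdeal`).

HIO prove (21.11) from Thm. (21.9)/(21.10) by graded-module arguments and deduce (21.12); here (21.12) (the tree's
Bennett route) is the input and (21.11) the output — the implication of record is the printed (1) ⇒ (2). Written for
the cell res-hironaka (HIRONAKA-L librarian seat res-D-lib-1; consumer: W4.2 T7b `theorem314_geomDir_of_facts`, input
«F-split»). AI-written; AI review is weaker than expert review.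

## References

* M. Herrmann, S. Ikeda, U. Orbanz, *Equimultiplicity and Blowing up*, Springer 1988, §21: (21.7), Thm. (21.9),
  Thm. (21.10), Cor. (21.11), Cor. (21.12). [HerrmannIkedaOrbanz1988]
* V. Cossart, U. Jannsen, S. Saito, LNM 2270 (2020), Thm. 3.2 (2) p. 37–38, Thm. 3.3, Lemma 2.37 (1).
  [CossartJannsenSaito2020]
* H. Hironaka, J. Math. Kyoto Univ. 10 (1970), p. 170 L4–5, p. 153 L22–28. [Hironaka1970NumericalCharacters]
-/

noncomputable section

open IsLocalRing MvPolynomial Finset Module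
open Literature.RingTheory.MvPolynomial

namespace Literature.RingTheory.HilbertSamuel

universe u

variable {A : Type u} [CommRing A] [IsLocalRing A] {m : ℕ}

/-! ## The fibre of the normal cone has at most `μ(I^i)` independent forms of degree `i` -/

/-- **`dim_k (k[X]/J_D)_i ≤ μ(I^i)`**: the degree-`i` piece of `Sym_k(I/𝔪I)/J_D = ⊕ I^i/𝔪I^i` is spanned by the
classes of any generating set of `I^i`. Concretely: if `w_1, …, w_μ` generate `I^i` (`μ = μ(I^i)` minimal) and
`W_j` are forms of degree `i` over `A` with `W_j(g) = w_j`, then every monomial `X^α` of degree `i` satisfies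
`g^α = Σ_j a_j w_j`, so `X^α − Σ_j a_j W_j` has value `0 ∈ 𝔪 I^i` at `g` and its reduction lies in
`normalConeForms g i`; hence `k[X]_i ⊆ k⟨W̄_1, …, W̄_μ⟩ + (J_D)_i`. [cite: HerrmannIkedaOrbanz1988, (21.7) (the surjection onto G(I,R) ⊗ R/L)]
[cite: Hironaka1970NumericalCharacters, §2 p. 152–153 (C_{X,D,x} ⊆ Spec Sym(I/𝔪I))] -/
theorem hilbertFunQuot_normalConeIdeal_le_spanFinrank [IsNoetherianRing A] (g : Fin m → A) (i : ℕ) :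
    hilbertFunQuot (ResidueField A) m (normalConeIdeal g) i ≤ (Ideal.span (Set.range g) ^ i).spanFinrank := by
  classical
  set k := ResidueField A
  set I : Ideal A := Ideal.span (Set.range g) with hI
  -- a minimal generating set of `I^i`
  obtain ⟨G, hGcard, hGspan⟩ :=
    Submodule.FG.exists_span_finset_card_eq_spanFinrank (IsNoetherian.noetherian (I ^ i))
  have hGmem : ∀ w ∈ G, w ∈ I ^ i := fun w hw => by
    rw [← hGspan]; exact Submodule.subset_span hw
  -- forms `W w` of degree `i` with `W w (g) = w`
  have hW : ∀ w : A, w ∈ I ^ i → ∃ W : MvPolynomial (Fin m) A, W.IsHomogeneous i ∧ eval g W = w :=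
    fun w hw => (Ideal.mem_span_pow_iff_exists_isHomogeneous g w).mp hw
  choose! W hWhom hWeval using hW
  -- the span `V` of their reductions
  set V : Submodule k (MvPolynomial (Fin m) k) :=
    Submodule.span k ((G.image fun w => MvPolynomial.map (residue A) (W w) : Finset _) : Set _) with hV
  set J := idealDegree (normalConeIdeal g) i with hJ
  haveI : Module.Finite k (homogeneousSubmodule (Fin m) k i) :=
    Module.Finite.iff_fg.mpr (homogeneousSubmodule_fg (Fin m) k i)
  have hJle : J ≤ homogeneousSubmodule (Fin m) k i := inf_le_right
  haveI : Module.Finite k J :=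
    Module.Finite.of_injective (Submodule.inclusion hJle) (Submodule.inclusion_injective hJle)
  haveI : Module.Finite k V := Module.Finite.span_of_finite k (Finset.finite_toSet _)
  -- KEY: `k[X]_i ⊆ V + J_i`
  have hle : homogeneousSubmodule (Fin m) k i ≤ V ⊔ J := by
    intro f hf
    rw [mem_homogeneousSubmodule] at hf
    rw [f.as_sum]
    refine Submodule.sum_mem _ fun α hα => ?_
    have hαdeg : α.degree = i := by
      by_contra hne
      exact (mem_support_iff.mp hα) (hf.coeff_eq_zero hne)
    -- `monomial α c = c • monomial α 1`
    rw [show monomial α (coeff α f) = coeff α f • monomial α (1 : k) by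
      rw [smul_monomial, smul_eq_mul, mul_one]]
    refine Submodule.smul_mem _ _ ?_
    -- `g^α ∈ I^i = span G`
    set gα : A := eval g (monomial α (1 : A)) with hgα
    have hgαmem : gα ∈ I ^ i :=
      (Ideal.mem_span_pow_iff_exists_isHomogeneous g gα).mpr ⟨monomial α 1, isHomogeneous_monomial _ hαdeg, rfl⟩
    rw [← hGspan] at hgαmem
    obtain ⟨c, hcsupp, hcsum⟩ := Submodule.mem_span_set.mp hgαmem
    -- the form `F = X^α − Σ_w c_w W_w` over `A`
    set F : MvPolynomial (Fin m) A := monomial α 1 - c.sum fun w r => C r * W w with hF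
    have hcmem : ∀ w ∈ c.support, w ∈ I ^ i := fun w hw => hGmem w (hcsupp hw)
    have hFhom : F.IsHomogeneous i := by
      refine (isHomogeneous_monomial _ hαdeg).sub ?_
      rw [Finsupp.sum]
      exact IsHomogeneous.sum _ _ _ fun w hw => (hWhom w (hcmem w hw)).C_mul _
    have hFeval : eval g F = 0 := by
      have hsum : eval g (c.sum fun w r => C r * W w) = c.sum fun w r => r • w := by
        rw [Finsupp.sum, Finsupp.sum, map_sum]
        refine Finset.sum_congr rfl fun w hw => ?_
        rw [map_mul, eval_C, hWeval w (hcmem w hw), smul_eq_mul]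
      rw [hF, map_sub, hsum, hcsum, hgα, sub_self]
    have hFmem : MvPolynomial.map (residue A) F ∈ J := by
      refine mem_idealDegree.mpr ⟨mem_normalConeIdeal_of_mem_normalConeForms g ⟨F, hFhom, ?_, rfl⟩,
        hFhom.map _⟩
      rw [hFeval]; exact Ideal.zero_mem _
    -- `X^α = F̄ + Σ_w c̄_w W̄_w`
    have hmapF : MvPolynomial.map (residue A) F =
        monomial α 1 - c.sum fun w r => C (residue A r) * MvPolynomial.map (residue A) (W w) := by
      rw [hF, map_sub, map_monomial, map_one (residue A), Finsupp.sum, Finsupp.sum, map_sum]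
      simp only [map_mul, map_C]
    have hsplit : (monomial α (1 : k) : MvPolynomial (Fin m) k) =
        MvPolynomial.map (residue A) F + c.sum fun w r => C (residue A r) * MvPolynomial.map (residue A) (W w) := by
      rw [hmapF, sub_add_cancel]
    rw [hsplit]
    refine Submodule.add_mem _ (Submodule.mem_sup_right hFmem) (Submodule.mem_sup_left ?_)
    rw [Finsupp.sum]
    refine Submodule.sum_mem _ fun w hw => ?_
    rw [show C (residue A (c w)) * MvPolynomial.map (residue A) (W w) =
      residue A (c w) • MvPolynomial.map (residue A) (W w) by rw [smul_eq_C_mul]]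
    refine Submodule.smul_mem _ _ (Submodule.subset_span ?_)
    rw [Finset.mem_coe, Finset.mem_image]
    exact ⟨w, hcsupp hw, rfl⟩
  -- count
  have h1 : finrank k (homogeneousSubmodule (Fin m) k i) ≤ finrank k V + finrank k J :=
    (Submodule.finrank_mono hle).trans (Submodule.finrank_add_le_finrank_add_finrank V J)
  have h2 : finrank k V ≤ G.card := by
    refine (finrank_span_finset_le_card _).trans ?_
    exact Finset.card_image_le
  unfold hilbertFunQuot
  rw [← hGcard]
  change finrank k (homogeneousSubmodule (Fin m) k i) - finrank k J ≤ G.card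
  omega

/-! ## The discharge -/

/-- **HIO Cor. (21.11) (1) ⇒ (2) / CJS Thm. 3.2 (2) (i) ⇒ (iii) DISCHARGED — the Hironaka–Grothendieck isomorphism
`(gr_I(A) ⊗ k)[T_1, …, T_s] ≅ gr_𝔪(A)` along a regular, normally flat centre**, in the typed form `J_z = J_D · k[Z]`
(`HerrmannIkedaOrbanz1988_cor_21_11` verbatim). Proof: `⊇` is the typed file's
`map_rename_normalConeIdeal_le_tangentConeIdeal`; both sides are homogeneous ideals, and in each degree `d`
`dim (k[Z]/J_D k[Z])_d = Σ_{i≤d} dim (k[X]/J_D)_i Φ^{(s)}(d−i) ≤ Σ_{i≤d} μ(I^i) Φ^{(s)}(d−i) ≤ H^{(s)}[A_I](d) = H^{(0)}[A](d)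
 = dim (k[Z]/J_z)_d` (normal flatness via CJS Thm. 3.3 / HIO (21.12)), so the degree-`d` parts coincide.
[cite: HerrmannIkedaOrbanz1988, Cor. (21.11) (1)⇒(2); Cor. (21.12)] [cite: CossartJannsenSaito2020, Thm. 3.2 (2) (i)⇒(iii) p. 37–38; Thm. 3.3]
[cite: Hironaka1970NumericalCharacters, p. 170 L4–5] -/
theorem HerrmannIkedaOrbanz1988_cor_21_11_holds : HerrmannIkedaOrbanz1988_cor_21_11.{u} := by
  intro A _ _ _ I m s g y hz hI hreg hNF hdim
  classical
  haveI := hreg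
  haveI : IsDomain (A ⧸ I) := Literature.AlgebraicGeometry.Resolution.isDomain_of_isRegularLocalRing (A ⧸ I)
  haveI hIprime : I.IsPrime := (Ideal.Quotient.isDomain_iff_prime I).mp inferInstance
  set k := ResidueField A
  set ρ : MvPolynomial (Fin m) k →+* MvPolynomial (Fin (m + s)) k :=
    ((rename (Fin.castAdd s) : MvPolynomial (Fin m) k →ₐ[k] MvPolynomial (Fin (m + s)) k) :
      MvPolynomial (Fin m) k →+* MvPolynomial (Fin (m + s)) k) with hρ
  set Jz := tangentConeIdeal (Fin.append g y) hz with hJz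
  set J' := (normalConeIdeal g).map ρ with hJ'
  -- (1) the trivial half
  have hle : J' ≤ Jz := map_rename_normalConeIdeal_le_tangentConeIdeal g y hz
  -- (2) `𝔪 = I + (y)`
  have hm : maximalIdeal A = I ⊔ Ideal.span (Set.range y) := by
    rw [← hz, ← hI, ← Ideal.span_union]
    congr 1
    ext a
    simp only [Set.mem_range, Set.mem_union]
    constructor
    · rintro ⟨j, rfl⟩
      refine Fin.addCases (fun l => ?_) (fun l => ?_) j
      · exact Or.inl ⟨l, (Fin.append_left g y l).symm⟩
      · exact Or.inr ⟨l, (Fin.append_right g y l).symm⟩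
    · rintro (⟨l, rfl⟩ | ⟨l, rfl⟩)
      · exact ⟨Fin.castAdd s l, Fin.append_left g y l⟩
      · exact ⟨Fin.natAdd m l, Fin.append_right g y l⟩
  -- (3) the Hilbert-function inequality `H(k[Z]/J')(d) ≤ H^{(0)}[A](d)`
  have hfree : ∀ i, Module.Free (A ⧸ I) (gradedPiece I i) := fun i => by
    haveI := hNF i
    haveI : Module.Finite (A ⧸ I) (gradedPiece I i) := Module.Finite.of_restrictScalars_finite A _ _
    exact Module.free_of_flat_of_isLocalRing
  have hH : ∀ d, hilbertFunQuot k (m + s) J' d ≤ hilbertFun A d := fun d => by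
    have hs : ringKrullDim (A ⧸ I) = (s : ℕ) := hdim
    calc hilbertFunQuot k (m + s) J' d
        = iterPSum s (hilbertFunQuot k m (normalConeIdeal g)) d := hilbertFunQuot_map_rename_castAdd _ s d
      _ = ∑ i ∈ range (d + 1), hilbertFunQuot k m (normalConeIdeal g) i * iterPSum s Phi (d - i) :=
          (sum_mul_iterPSum_Phi s _ d).symm
      _ ≤ ∑ i ∈ range (d + 1), (I ^ i).spanFinrank * iterPSum s Phi (d - i) :=
          sum_le_sum fun i _ => Nat.mul_le_mul_right _ (by
            rw [← hI]; exact hilbertFunQuot_normalConeIdeal_le_spanFinrank g i)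
      _ ≤ ∑ i ∈ range (d + 1), hilbertFun (Localization.AtPrime I) i * iterPSum s Phi (d - i) :=
          sum_le_sum fun i _ => by
            haveI := hfree i
            exact Nat.mul_le_mul_right _ (spanFinrank_pow_le_hilbertFun_of_free I (Localization.AtPrime I) i)
      _ = hilbertSamuelFun (Localization.AtPrime I) s d := sum_mul_iterPSum_Phi s _ d
      _ = hilbertFun A d := by
          rw [hilbertFun_eq_hilbertSamuelFun_of_isNormallyFlat I (Localization.AtPrime I) hs hNF]
  -- (4) degreewise equality of the homogeneous parts
  haveI hfin : ∀ d, Module.Finite k (homogeneousSubmodule (Fin (m + s)) k d) := fun d =>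
    Module.Finite.iff_fg.mpr (homogeneousSubmodule_fg (Fin (m + s)) k d)
  have hdeg : ∀ d, idealDegree J' d = idealDegree Jz d := fun d => by
    have hsub : idealDegree J' d ≤ idealDegree Jz d := fun f hf =>
      mem_idealDegree.mpr ⟨hle (mem_idealDegree.mp hf).1, (mem_idealDegree.mp hf).2⟩
    have hJzle : idealDegree Jz d ≤ homogeneousSubmodule (Fin (m + s)) k d := inf_le_right
    haveI : Module.Finite k (idealDegree Jz d) :=
      Module.Finite.of_injective (Submodule.inclusion hJzle) (Submodule.inclusion_injective hJzle)
    refine Submodule.eq_of_le_of_finrank_le hsub ?_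
    -- `dim J_z,d ≤ dim J'_d` from `H(k[Z]/J')(d) ≤ H(d) = H(k[Z]/J_z)(d)`
    have h1 := hH d
    rw [← hilbertFunQuot_tangentConeIdeal (Fin.append g y) hz] at h1
    unfold hilbertFunQuot at h1
    have h2 : finrank k (idealDegree Jz d) ≤ finrank k (homogeneousSubmodule (Fin (m + s)) k d) :=
      Submodule.finrank_mono hJzle
    change finrank k (homogeneousSubmodule (Fin (m + s)) k d) - finrank k (idealDegree J' d) ≤
      finrank k (homogeneousSubmodule (Fin (m + s)) k d) - finrank k (idealDegree Jz d) at h1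
    exact (Nat.sub_le_sub_iff_left h2).mp h1
  -- (5) conclude
  refine le_antisymm (fun f hf => ?_) hle
  rw [← sum_homogeneousComponent f]
  refine Ideal.sum_mem _ fun d _ => ?_
  have hc : homogeneousComponent d f ∈ idealDegree Jz d :=
    mem_idealDegree.mpr ⟨isHomogeneousIdeal_tangentConeIdeal _ hz f hf d, homogeneousComponent_isHomogeneous d f⟩
  rw [← hdeg d] at hc
  exact (mem_idealDegree.mp hc).1

end Literature.RingTheory.HilbertSamuel

end
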